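import Literature.MathematicalPhysics.QuantumFieldTheory.Balaban1983to89.Node00.Record12BgRowCoClassCPM
import Literature.MathematicalPhysics.QuantumFieldTheory.Balaban1983to89.Node00.CriticalOnFibreTopGuarded

/-!
# NODE 00 — ROW P11's GUARDED [15] THEOREM-1 SENTENCE, FLOOR-CARRYING: `VariationalThm1RegSepTop7MR F N Sup c B₃ a₀ a₁` ∕ `VariationalThm1RegSepCoP7MR F N c B₃ a₀ a₁` — FILE 12d's
# `…Top7M ∕ …CoP7M` asked only of numerics with `c ≤ ν.M₁` —, its pointwise accessors with the floor threaded, and module 20's minimiser lemma with the floor (the (8)-side half of the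
# floor-carrying stub-1 chain; the (9)-side half is `Node00/TorusCoverGaugeTokensRFloor`)

Cell `pub-ymgap` (HUMAN RULINGS D-0062 ∕ D-0088), seat `pub-ymgap-dag-n07-e` g20 (R141 (C) row s3 lineage; DAG node N07 = [B11]; lane owner; declarer of modules 20 ∕ 46–48), 2026-08-28.
`--kind definition --supports stmt-QuantumFields-20541` (K0⁷; count-neutral).  Consumer-side sequel of LOCATED-STUB1-FLOOR (cell bus 2026-08-28 08:50Z; head's ANSWER 09:09Z).
Additive — FILE 12d (node00-def-P11) is NOT edited; this is a new leaf.

THE PRINT.  [B11] = T. Bałaban, CMP **102** (1985) 277–309 `[Balaban1985Variational]`: Thm 1 (7)–(8) pp. 278–279 and Prop. 8 p. 304 are statements about the numerics OF THE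
CONSTRUCTION — p. 304 lines 1–2 *«We may assume that R₁M₁ is sufficiently big, so that (163)»*; [6] = CMP **99** (1985) `[Balaban1985RegularSpaces]` (1.3)–(1.6) p. 77 *«M … R a big
positive integer which will be fixed later»*.  On the tree the K0 body consumes Thm 1's (8)-sentence as FILE 12d's floor-free `VariationalThm1RegSepCoP7M F N B₃ a₀ a₁` (every `ν`
with `0 < ν.M₁`), derived from the floor-free stub-1 fact (`variationalThm1RegSepCoP7M_of_prop8TopStep`); it is APPLIED at exactly one place — node00-def-K0a's
`Record12BgRowCoClassGaugeR` §3 `plaqSmallOn_of_thm1RegSepTop7M h15 ν M g K k …` — at the prefix of the collared witness `θ₁₅ᶜᶜᴹ(j)` (`ν.M₁ = L^j`), where the floor witness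
`hc : c ≤ ν.M₁` of the (9)-sentence is ALREADY in scope.  Once stub 1 is read floor-carrying (module 46 `Prop8RegSepTopStepR … c …`), the (8)-sentence it yields is floor-carrying
too; THIS FILE names it and threads `hc` through 12d's accessors, so K0a's §3–§5 and dag-n21-c's FILE B re-key by ONE binder.

WHAT IS PROVED (sorry-free; FOUR definitions (named facts, `Prop`s, never asserted); axioms standard).
* §1 `VariationalThm1RegSepTop7MR F N Sup c B₃ a₀ a₁` (12d's `…Top7M` with the binder `c ≤ ν.M₁` right after `0 < ν.M₁`), `VariationalThm1RegSepCoP7MR F N c B₃ a₀ a₁` (at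
  `Sup := suppDomOfRecord`); `VariationalThm1RegSepTop7M.toR` ∕ `VariationalThm1RegSepCoP7M.toR` (floor-free ⇒ every floor), `.of_le` (antitone in `a₀ a₁`), `.mono_floor`,
  `…Top7MR_zero_iff` ∕ `…CoP7MR_zero_iff` (`c = 0` is 12d's fact), the definitional bridges `…CoP7MR.toTop7MR` ∕ `…Top7MR.toCoP7MR`.
* §2 the pointwise accessors with the floor: `plaqSmallOn_of_thm1RegSepTop7MR`, `coDivSmallOn_of_thm1RegSepTop7MR` (12d §2 with `(hc : c ≤ ν.M₁)` after `hM₁`),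
  `plaqSmallOn_UbgMSCoPOfRecord_of_thm1RegSepCoP7MR`, `coDivSmallOn_UbgMSCoPOfRecord_of_thm1RegSepCoP7MR` (12d §3's, at node00-def-R's collar-class minimiser).
* §3 ★ `regular_of_isMinimizer_classTop_of_prop8TopStepR` — module 20's `regular_of_isMinimizer_classTop_of_prop8TopStep` from the FLOOR-CARRYING stub-1 fact, pointwise with `hc`
  (minimal over the open class ⇒ critical on the fibre ⇒ Prop. 8's top step at this prefix).
* §4 the GUARD-GENERIC editions in module 47's currency (`Adm : StepGuard F`, binder `Adm ν M g K k s` after `0 < ν.M₁`): defs `VariationalThm1RegSepTop7MG ∕ …CoP7MG F N [Sup] Adm B₃ a₀ a₁`,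
  `…Top7M.toG ∕ …CoP7M.toG`, `.of_le`, `.of_imp` (antitone in the guard), `…_top_iff`, `…R_iff_G_floorGuard` (§1 IS the instance `floorGuard F c`, `Iff.rfl`), the accessors
  `plaqSmallOn_of_thm1RegSepTop7MG ∕ coDivSmallOn_of_thm1RegSepTop7MG` (`hadm : Adm ν M g K k s`), ★ `regular_of_isMinimizer_classTop_of_prop8TopStepG` — so that a V20 text naming a
  CONCRETE two-part guard (floor ∧ the head's level guard) re-keys the (8)-side consumers by the same one binder.
NOT HERE: `variationalThm1RegSepTop7MR_of_prop8TopStepR` (the `k = 0` flat case uses Summits-side lemmas — the Summits twin `…N07Thm1Top7FromProp8Floor`), node00-def-K0a's row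
lemmas at the floor-carrying sentence (`bgRowAtDatumU_of_thm1RegSepTop7MR_of_thm1GaugeR` …: K0a's §3–§5 with `h15 ↦ h15R`, ONE `have` re-sourced to §2 here), the K0 skeleton text (plan, V20).
HONEST SCOPE.  Definitions of named facts + binder-threading bookkeeping; nothing of [B11]'s analysis asserted or proved; the floor-free facts are NOT claimed false; `stub_prop8StepCoP13` ∕
K0⁷ NOT closed; N07 NOT discharged; counts unmoved (28∕28 · 5∕27); one finite 𝕋⁴ programme at fixed ε — the route closes the conditional finite-𝕋⁴ rung `BalabanLadder.UV` only; nothing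
continuum ∕ ℝ⁴ ∕ OS ∕ mass gap ∕ Clay.  No `sorry`, no `instance`, no `notation`.

References: [B11] (1) p.277, Thm 1 (2)–(8) pp.278–279, p.304 lines 1–2, Prop. 8 p.304; [6] (1.3)–(1.9) p.77; [Balaban1988Convergent] p.255, (2.6)–(2.8) pp.255–256, (2.12) p.256.
-/

noncomputable section

open MeasureTheory
open scoped Matrix.Norms.L2Operator

namespace Literature.MathematicalPhysics.QuantumFieldTheory.Balaban1983to89.Node00

open T4Continuum (T4Family)
open B15DeterminingSets B12RegularSpaces111

/-! ## §1  The floor-carrying guarded sentences -/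

section NamedFactTopMR

variable (F : T4Family) (N : ℕ) [NeZero N]

/-- **[15] THEOREM 1 ((8) for minimisers over class (6) on a top domain), GUARDED AND FLOOR-CARRYING**: FILE 12d's `VariationalThm1RegSepTop7M` with ONE more binder `c ≤ ν.M₁` after
`0 < ν.M₁` (print's «M₁ … R₁ … sufficiently big»).  A `Prop` with parameters, NEVER asserted. [cite: Balaban1985Variational, Thm 1 (2),(6),(7)–(8) pp.278–279, p.304 lines 1–2; Balaban1985RegularSpaces, (1.3)–(1.6) p.77] -/
def VariationalThm1RegSepTop7MR (Sup : (ν : Stage7Numerics) → (K : ℕ) → (ℕ → Set (Site (F.P K) 0)) → Set (Site (F.P K) 0)) (c : ℕ) (B₃ a₀ a₁ : ℝ) : Prop :=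
  ∀ (ν : Stage7Numerics) (M : ℕ) (g : ℕ → ℝ) (K k : ℕ) (s : SeqOfRecord F ν M g K k), Sect2.SeqSeparated ν.M₁ s → 0 < ν.M₁ → c ≤ ν.M₁ → ∀ (ε₀ : ℝ) (δ : ℕ → ℝ),
    (∀ n, n ≤ k → 0 < δ n ∧ δ n ≤ a₁ ∧ B₃ * δ n ≤ ε₀) → (∀ n, n < k → δ n ≤ 2 * δ (n + 1)) → (∀ n, n < k → δ (n + 1) ≤ 2 * δ n) → ε₀ ≤ a₀ →
    ∀ W : MSField (F.P K) (SU N), Sect2.DataSmall7PTop (avOfRecord F N K) s.Ω (Sup ν K s.Ω) k δ W →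
      ∀ U₀, IsMinimizer (avOfRecord F N K)
          {U | (∀ n, n ≤ k → PlaqSmallOn (Sect2.omegaPlaqsTop s.Ω (Sup ν K s.Ω) n) (ε₀ * (F.P K).eta n ^ 2) U) ∧
            Sect2.CoDivClassOnTop s.Ω (Sup ν K s.Ω) k ε₀ U} (genSet s.Ω k) W U₀ →
        (∀ n, n ≤ k → PlaqSmallOn (Sect2.omegaPlaqsTop s.Ω (Sup ν K s.Ω) n) (B₃ * δ n * (F.P K).eta n ^ 2) U₀) ∧
          ∀ n, n ≤ k → Sect2.CoDivSmallOn (Sect2.omegaBondsTop s.Ω (Sup ν K s.Ω) n) (B₃ * δ n * (F.P K).eta n ^ 3) U₀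

/-- **THE v1.5 `CoP` EDITION, FLOOR-CARRYING**: §1's sentence at node00-def-R's selector `Sup := suppDomOfRecord` (12d's `VariationalThm1RegSepCoP7M` with the floor).
[cite: Balaban1985Variational, Thm 1 (7)–(8) pp.278–279, p.304 lines 1–2; Balaban1985RegularSpaces, (1.3)–(1.6) p.77; Balaban1988Convergent, p.255, (2.12) p.256] -/
def VariationalThm1RegSepCoP7MR (c : ℕ) (B₃ a₀ a₁ : ℝ) : Prop :=
  VariationalThm1RegSepTop7MR F N (fun ν K Ω => suppDomOfRecord F ν K Ω) c B₃ a₀ a₁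

variable {F N}

/-- Floor-free (12d) ⇒ floor-carrying, every floor. [cite: Balaban1985Variational, Thm 1 (8) p.279 (bookkeeping)] -/
theorem VariationalThm1RegSepTop7M.toR {Sup : (ν : Stage7Numerics) → (K : ℕ) → (ℕ → Set (Site (F.P K) 0)) → Set (Site (F.P K) 0)} {B₃ a₀ a₁ : ℝ}
    (h : VariationalThm1RegSepTop7M F N Sup B₃ a₀ a₁) (c : ℕ) : VariationalThm1RegSepTop7MR F N Sup c B₃ a₀ a₁ :=
  fun ν M g K k s hsep hM₁ _ => h ν M g K k s hsep hM₁

/-- Antitone in the ceilings `a₀ a₁`. [cite: Balaban1985Variational, Thm 1 p.279 (the range «ε₀ ≤ a₀», «ε₁ ≤ a₁»)] -/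
theorem VariationalThm1RegSepTop7MR.of_le {Sup : (ν : Stage7Numerics) → (K : ℕ) → (ℕ → Set (Site (F.P K) 0)) → Set (Site (F.P K) 0)} {c : ℕ} {B₃ a₀ a₀' a₁ a₁' : ℝ}
    (h : VariationalThm1RegSepTop7MR F N Sup c B₃ a₀ a₁) (ha₀ : a₀' ≤ a₀) (ha₁ : a₁' ≤ a₁) : VariationalThm1RegSepTop7MR F N Sup c B₃ a₀' a₁' :=
  fun ν M g K k s hsep hM₁ hc ε₀ δ hnum hcomp hcomp' hε W h7 U₀ hmin =>
    h ν M g K k s hsep hM₁ hc ε₀ δ (fun n hn => ⟨(hnum n hn).1, (hnum n hn).2.1.trans ha₁, (hnum n hn).2.2⟩) hcomp hcomp' (hε.trans ha₀) W h7 U₀ hmin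

/-- Monotone in the floor. [cite: Balaban1985RegularSpaces, (1.3)–(1.6) p.77 (bookkeeping)] -/
theorem VariationalThm1RegSepTop7MR.mono_floor {Sup : (ν : Stage7Numerics) → (K : ℕ) → (ℕ → Set (Site (F.P K) 0)) → Set (Site (F.P K) 0)} {c c' : ℕ} {B₃ a₀ a₁ : ℝ}
    (h : VariationalThm1RegSepTop7MR F N Sup c B₃ a₀ a₁) (hcc : c ≤ c') : VariationalThm1RegSepTop7MR F N Sup c' B₃ a₀ a₁ :=
  fun ν M g K k s hsep hM₁ hc' => h ν M g K k s hsep hM₁ (hcc.trans hc')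

/-- At floor `0` the floor-carrying sentence IS 12d's. [cite: Balaban1985Variational, Thm 1 (8) p.279 (bookkeeping)] -/
theorem variationalThm1RegSepTop7MR_zero_iff {Sup : (ν : Stage7Numerics) → (K : ℕ) → (ℕ → Set (Site (F.P K) 0)) → Set (Site (F.P K) 0)} {B₃ a₀ a₁ : ℝ} :
    VariationalThm1RegSepTop7MR F N Sup 0 B₃ a₀ a₁ ↔ VariationalThm1RegSepTop7M F N Sup B₃ a₀ a₁ :=
  ⟨fun h ν M g K k s hsep hM₁ => h ν M g K k s hsep hM₁ (Nat.zero_le _), fun h => h.toR 0⟩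

/-- Definitional bridge (`CoP` ⇒ `Top` at the selector of record). [cite: Balaban1985Variational, Thm 1 (8) p.279 (bookkeeping)] -/
theorem VariationalThm1RegSepCoP7MR.toTop7MR {c : ℕ} {B₃ a₀ a₁ : ℝ} (h : VariationalThm1RegSepCoP7MR F N c B₃ a₀ a₁) :
    VariationalThm1RegSepTop7MR F N (fun ν K Ω => suppDomOfRecord F ν K Ω) c B₃ a₀ a₁ := h

/-- Conversely (definitional). [cite: Balaban1985Variational, Thm 1 (8) p.279 (bookkeeping)] -/
theorem VariationalThm1RegSepTop7MR.toCoP7MR {c : ℕ} {B₃ a₀ a₁ : ℝ} (h : VariationalThm1RegSepTop7MR F N (fun ν K Ω => suppDomOfRecord F ν K Ω) c B₃ a₀ a₁) :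
    VariationalThm1RegSepCoP7MR F N c B₃ a₀ a₁ := h

/-- Floor-free `CoP` (12d) ⇒ floor-carrying `CoP`, every floor. [cite: Balaban1985Variational, Thm 1 (8) p.279 (bookkeeping)] -/
theorem VariationalThm1RegSepCoP7M.toR {B₃ a₀ a₁ : ℝ} (h : VariationalThm1RegSepCoP7M F N B₃ a₀ a₁) (c : ℕ) : VariationalThm1RegSepCoP7MR F N c B₃ a₀ a₁ :=
  VariationalThm1RegSepTop7M.toR h c

/-- The floor-carrying `CoP` sentence is antitone in `a₀ a₁`. [cite: Balaban1985Variational, Thm 1 p.279 (bookkeeping)] -/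
theorem VariationalThm1RegSepCoP7MR.of_le {c : ℕ} {B₃ a₀ a₀' a₁ a₁' : ℝ} (h : VariationalThm1RegSepCoP7MR F N c B₃ a₀ a₁) (ha₀ : a₀' ≤ a₀) (ha₁ : a₁' ≤ a₁) :
    VariationalThm1RegSepCoP7MR F N c B₃ a₀' a₁' :=
  VariationalThm1RegSepTop7MR.of_le h ha₀ ha₁

/-- The floor-carrying `CoP` sentence is monotone in the floor. [cite: Balaban1985RegularSpaces, (1.3)–(1.6) p.77 (bookkeeping)] -/
theorem VariationalThm1RegSepCoP7MR.mono_floor {c c' : ℕ} {B₃ a₀ a₁ : ℝ} (h : VariationalThm1RegSepCoP7MR F N c B₃ a₀ a₁) (hcc : c ≤ c') :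
    VariationalThm1RegSepCoP7MR F N c' B₃ a₀ a₁ :=
  VariationalThm1RegSepTop7MR.mono_floor h hcc

/-- At floor `0` the floor-carrying `CoP` sentence IS 12d's. [cite: Balaban1985Variational, Thm 1 (8) p.279 (bookkeeping)] -/
theorem variationalThm1RegSepCoP7MR_zero_iff {B₃ a₀ a₁ : ℝ} : VariationalThm1RegSepCoP7MR F N 0 B₃ a₀ a₁ ↔ VariationalThm1RegSepCoP7M F N B₃ a₀ a₁ :=
  variationalThm1RegSepTop7MR_zero_iff

end NamedFactTopMR

/-! ## §2  FILE 12d's pointwise accessors WITH the floor -/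

section AccessorsR

variable {F : T4Family} {N : ℕ} [NeZero N]

/-- **EVERY MINIMISER OVER THE TOP-DOMAIN CLASS (6) AT THE RECORD's LETTERS IS `B₃·cR·ε_n`-REGULAR (plaquettes), AT NUMERICS MEETING THE FLOOR** — 12d's
`plaqSmallOn_of_thm1RegSepTop7M` with `(hc : c ≤ ν.M₁)`. [cite: Balaban1985Variational, Thm 1 (2),(6)–(8) pp.278–279; Balaban1985RegularSpaces, (1.3) p.77; Balaban1988Convergent, (2.6)–(2.8) pp.255–256, (2.12) p.256] -/
theorem plaqSmallOn_of_thm1RegSepTop7MR {Sup : (ν : Stage7Numerics) → (K : ℕ) → (ℕ → Set (Site (F.P K) 0)) → Set (Site (F.P K) 0)} {c : ℕ} {B₃ a₀ a₁ : ℝ}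
    (h15 : VariationalThm1RegSepTop7MR F N Sup c B₃ a₀ a₁) (ν : Stage7Numerics) (M : ℕ)
    (g : ℕ → ℝ) (K k : ℕ) (cR : ℝ) (s : SeqOfRecord F ν M g K k) (hsep : Sect2.SeqSeparated ν.M₁ s) (hM₁ : 0 < ν.M₁) (hc : c ≤ ν.M₁)
    (hnum : ∀ n, n ≤ k → 0 < cR * epsOfRecord ν g n ∧ cR * epsOfRecord ν g n ≤ a₁ ∧ B₃ * (cR * epsOfRecord ν g n) ≤ ν.εreg) (ha₀ : ν.εreg ≤ a₀)
    (hcomp : ∀ n, n < k → cR * epsOfRecord ν g n ≤ 2 * (cR * epsOfRecord ν g (n + 1)))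
    (hcomp' : ∀ n, n < k → cR * epsOfRecord ν g (n + 1) ≤ 2 * (cR * epsOfRecord ν g n))
    {W : MSField (F.P K) (SU N)} (h7 : Sect2.DataSmall7PTop (avOfRecord F N K) s.Ω (Sup ν K s.Ω) k (fun n => cR * epsOfRecord ν g n) W)
    {U₀ : GaugeField (F.P K) 0 (SU N)} (hmin : IsMinimizer (avOfRecord F N K)
      {U | (∀ n, n ≤ k → PlaqSmallOn (Sect2.omegaPlaqsTop s.Ω (Sup ν K s.Ω) n) (ν.εreg * (F.P K).eta n ^ 2) U) ∧
        Sect2.CoDivClassOnTop s.Ω (Sup ν K s.Ω) k ν.εreg U} (genSet s.Ω k) W U₀) :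
    ∀ n, n ≤ k → PlaqSmallOn (Sect2.omegaPlaqsTop s.Ω (Sup ν K s.Ω) n) (B₃ * (cR * epsOfRecord ν g n) * (F.P K).eta n ^ 2) U₀ :=
  (h15 ν M g K k s hsep hM₁ hc ν.εreg (fun n => cR * epsOfRecord ν g n) hnum hcomp hcomp' ha₀ W h7 U₀ hmin).1

/-- The co-divergence half, at numerics meeting the floor — 12d's `coDivSmallOn_of_thm1RegSepTop7M` with `(hc : c ≤ ν.M₁)`. [cite: Balaban1985Variational, Thm 1 (8) p.279; Balaban1985RegularSpaces, (1.9) p.77] -/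
theorem coDivSmallOn_of_thm1RegSepTop7MR {Sup : (ν : Stage7Numerics) → (K : ℕ) → (ℕ → Set (Site (F.P K) 0)) → Set (Site (F.P K) 0)} {c : ℕ} {B₃ a₀ a₁ : ℝ}
    (h15 : VariationalThm1RegSepTop7MR F N Sup c B₃ a₀ a₁) (ν : Stage7Numerics) (M : ℕ)
    (g : ℕ → ℝ) (K k : ℕ) (cR : ℝ) (s : SeqOfRecord F ν M g K k) (hsep : Sect2.SeqSeparated ν.M₁ s) (hM₁ : 0 < ν.M₁) (hc : c ≤ ν.M₁)
    (hnum : ∀ n, n ≤ k → 0 < cR * epsOfRecord ν g n ∧ cR * epsOfRecord ν g n ≤ a₁ ∧ B₃ * (cR * epsOfRecord ν g n) ≤ ν.εreg) (ha₀ : ν.εreg ≤ a₀)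
    (hcomp : ∀ n, n < k → cR * epsOfRecord ν g n ≤ 2 * (cR * epsOfRecord ν g (n + 1)))
    (hcomp' : ∀ n, n < k → cR * epsOfRecord ν g (n + 1) ≤ 2 * (cR * epsOfRecord ν g n))
    {W : MSField (F.P K) (SU N)} (h7 : Sect2.DataSmall7PTop (avOfRecord F N K) s.Ω (Sup ν K s.Ω) k (fun n => cR * epsOfRecord ν g n) W)
    {U₀ : GaugeField (F.P K) 0 (SU N)} (hmin : IsMinimizer (avOfRecord F N K)
      {U | (∀ n, n ≤ k → PlaqSmallOn (Sect2.omegaPlaqsTop s.Ω (Sup ν K s.Ω) n) (ν.εreg * (F.P K).eta n ^ 2) U) ∧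
        Sect2.CoDivClassOnTop s.Ω (Sup ν K s.Ω) k ν.εreg U} (genSet s.Ω k) W U₀) :
    ∀ n, n ≤ k → Sect2.CoDivSmallOn (Sect2.omegaBondsTop s.Ω (Sup ν K s.Ω) n) (B₃ * (cR * epsOfRecord ν g n) * (F.P K).eta n ^ 3) U₀ :=
  (h15 ν M g K k s hsep hM₁ hc ν.εreg (fun n => cR * epsOfRecord ν g n) hnum hcomp hcomp' ha₀ W h7 U₀ hmin).2

/-- **def-R's COLLAR-CLASS BACKGROUND `UbgMSCoPOfRecord … s 𝐖` IS `B₃·cR·ε_n`-REGULAR ON THE SOLVABLE SET, AT NUMERICS MEETING THE FLOOR** (plaquette half) — 12d §3's accessor with `hc`.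
[cite: Balaban1985Variational, Thm 1 (2),(6)–(8) pp.278–279; Balaban1985RegularSpaces, (1.3) p.77; Balaban1988Convergent, (2.12)–(2.13) p.256] -/
theorem plaqSmallOn_UbgMSCoPOfRecord_of_thm1RegSepCoP7MR {c : ℕ} {B₃ a₀ a₁ : ℝ} (h15 : VariationalThm1RegSepCoP7MR F N c B₃ a₀ a₁) (ν : Stage7Numerics) (M : ℕ)
    (g : ℕ → ℝ) (K k : ℕ) (cR : ℝ) (s : SeqOfRecord F ν M g K k) (hsep : Sect2.SeqSeparated ν.M₁ s) (hM₁ : 0 < ν.M₁) (hc : c ≤ ν.M₁)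
    (hnum : ∀ n, n ≤ k → 0 < cR * epsOfRecord ν g n ∧ cR * epsOfRecord ν g n ≤ a₁ ∧ B₃ * (cR * epsOfRecord ν g n) ≤ ν.εreg) (ha₀ : ν.εreg ≤ a₀)
    (hcomp : ∀ n, n < k → cR * epsOfRecord ν g n ≤ 2 * (cR * epsOfRecord ν g (n + 1)))
    (hcomp' : ∀ n, n < k → cR * epsOfRecord ν g (n + 1) ≤ 2 * (cR * epsOfRecord ν g n))
    {W : MSField (F.P K) (SU N)} (h7 : Sect2.DataSmall7PTop (avOfRecord F N K) s.Ω (suppDomOfRecord F ν K s.Ω) k (fun n => cR * epsOfRecord ν g n) W)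
    (hsol : W ∈ solvableDom (avOfRecord F N K) (regMSCoPOfRecord F N ν K k s.Ω) (genSet s.Ω k)) :
    ∀ n, n ≤ k → PlaqSmallOn (Sect2.omegaPlaqsTop s.Ω (suppDomOfRecord F ν K s.Ω) n) (B₃ * (cR * epsOfRecord ν g n) * (F.P K).eta n ^ 2) (UbgMSCoPOfRecord F N ν M g K k s W) :=
  plaqSmallOn_of_thm1RegSepTop7MR h15 ν M g K k cR s hsep hM₁ hc hnum ha₀ hcomp hcomp' h7 (isMinimizer_UbgMSCoPOfRecord ν M g K k s hsol)

/-- The co-divergence half at def-R's collar-class background on the solvable set, at numerics meeting the floor — 12d §3's accessor with `hc`.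
[cite: Balaban1985Variational, Thm 1 (8) p.279; Balaban1985RegularSpaces, (1.9) p.77] -/
theorem coDivSmallOn_UbgMSCoPOfRecord_of_thm1RegSepCoP7MR {c : ℕ} {B₃ a₀ a₁ : ℝ} (h15 : VariationalThm1RegSepCoP7MR F N c B₃ a₀ a₁) (ν : Stage7Numerics) (M : ℕ)
    (g : ℕ → ℝ) (K k : ℕ) (cR : ℝ) (s : SeqOfRecord F ν M g K k) (hsep : Sect2.SeqSeparated ν.M₁ s) (hM₁ : 0 < ν.M₁) (hc : c ≤ ν.M₁)
    (hnum : ∀ n, n ≤ k → 0 < cR * epsOfRecord ν g n ∧ cR * epsOfRecord ν g n ≤ a₁ ∧ B₃ * (cR * epsOfRecord ν g n) ≤ ν.εreg) (ha₀ : ν.εreg ≤ a₀)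
    (hcomp : ∀ n, n < k → cR * epsOfRecord ν g n ≤ 2 * (cR * epsOfRecord ν g (n + 1)))
    (hcomp' : ∀ n, n < k → cR * epsOfRecord ν g (n + 1) ≤ 2 * (cR * epsOfRecord ν g n))
    {W : MSField (F.P K) (SU N)} (h7 : Sect2.DataSmall7PTop (avOfRecord F N K) s.Ω (suppDomOfRecord F ν K s.Ω) k (fun n => cR * epsOfRecord ν g n) W)
    (hsol : W ∈ solvableDom (avOfRecord F N K) (regMSCoPOfRecord F N ν K k s.Ω) (genSet s.Ω k)) :
    ∀ n, n ≤ k → Sect2.CoDivSmallOn (Sect2.omegaBondsTop s.Ω (suppDomOfRecord F ν K s.Ω) n) (B₃ * (cR * epsOfRecord ν g n) * (F.P K).eta n ^ 3)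
      (UbgMSCoPOfRecord F N ν M g K k s W) :=
  coDivSmallOn_of_thm1RegSepTop7MR h15 ν M g K k cR s hsep hM₁ hc hnum ha₀ hcomp hcomp' h7 (isMinimizer_UbgMSCoPOfRecord ν M g K k s hsol)

end AccessorsR

/-! ## §3  Module 20's minimiser lemma from the FLOOR-CARRYING stub-1 fact -/

section MinimiserR

variable {F : T4Family} {N : ℕ} [NeZero N]

/-- ★ **THEOREM 1's (8) FOR MINIMISERS AT A GENUINE STEP, FROM PROPOSITION 8's FLOOR-CARRYING TOP STEP, AT NUMERICS MEETING THE FLOOR** — module 20's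
`regular_of_isMinimizer_classTop_of_prop8TopStep` with `h8 : Prop8RegSepTopStepR … c …` and `(hc : c ≤ ν.M₁)`: minimal over the open class ⇒ critical on the fibre
(`isCritOnFibre_of_isMinimizer_classTop`) ⇒ Prop. 8 at this prefix. [cite: Balaban1985Variational, Thm 1 (6)–(8) pp.278–279, p.299, Prop. 8 p.304, p.304 lines 1–2; Balaban1988Convergent, (2.12) p.256] -/
theorem regular_of_isMinimizer_classTop_of_prop8TopStepR {Sup : (ν : Stage7Numerics) → (K : ℕ) → (ℕ → Set (Site (F.P K) 0)) → Set (Site (F.P K) 0)}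
    {c : ℕ} {B₃ a₀ a₁ : ℝ} (h8 : Prop8RegSepTopStepR F N Sup c B₃ a₀ a₁) (ν : Stage7Numerics) (M : ℕ)
    (g : ℕ → ℝ) (K k : ℕ) (s : SeqOfRecord F ν M g K k) (hsep : Sect2.SeqSeparated ν.M₁ s) (hM₁ : 0 < ν.M₁) (hc : c ≤ ν.M₁) (hk : 1 ≤ k) (ε₀ : ℝ)
    (δ : ℕ → ℝ) (hδ : ∀ n, n ≤ k → 0 < δ n ∧ δ n ≤ a₁ ∧ B₃ * δ n ≤ ε₀) (hcomp : ∀ n, n < k → δ n ≤ 2 * δ (n + 1))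
    (hcomp' : ∀ n, n < k → δ (n + 1) ≤ 2 * δ n) (hε₀ : ε₀ ≤ a₀)
    (W : MSField (F.P K) (SU N)) (h7 : Sect2.DataSmall7PTop (avOfRecord F N K) s.Ω (Sup ν K s.Ω) k δ W) {U₀ : GaugeField (F.P K) 0 (SU N)}
    (hU₀ : IsMinimizer (avOfRecord F N K)
      {U | (∀ n, n ≤ k → PlaqSmallOn (Sect2.omegaPlaqsTop s.Ω (Sup ν K s.Ω) n) (ε₀ * (F.P K).eta n ^ 2) U) ∧
        Sect2.CoDivClassOnTop s.Ω (Sup ν K s.Ω) k ε₀ U} (genSet s.Ω k) W U₀) :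
    (∀ n, n ≤ k → PlaqSmallOn (Sect2.omegaPlaqsTop s.Ω (Sup ν K s.Ω) n) (B₃ * δ n * (F.P K).eta n ^ 2) U₀) ∧
      ∀ n, n ≤ k → Sect2.CoDivSmallOn (Sect2.omegaBondsTop s.Ω (Sup ν K s.Ω) n) (B₃ * δ n * (F.P K).eta n ^ 3) U₀ :=
  h8 ν M g K k s hsep hM₁ hc hk ε₀ δ hδ hcomp hcomp' hε₀ W h7 U₀ hU₀.1.1 hU₀.1.2 hU₀.2.1 (isCritOnFibre_of_isMinimizer_classTop hU₀)

end MinimiserR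


/-! ## §4  The guard-generic editions (module 47's currency `Adm : StepGuard F`) -/

section NamedFactTopMG

variable (F : T4Family) (N : ℕ) [NeZero N]

/-- **[15] THEOREM 1 ((8) for minimisers), GUARDED BY AN ARBITRARY PREFIX PREDICATE**: FILE 12d's `VariationalThm1RegSepTop7M` with ONE more binder `Adm ν M g K k s` after `0 < ν.M₁`
(module 47's `StepGuard`).  A `Prop` with parameters, NEVER asserted; the K0 skeleton names a CONCRETE guard (never a free `Adm`). [cite: Balaban1985Variational, Thm 1 (7)–(8) pp.278–279, p.304 lines 1–2; Balaban1987RG1, (0.1) p.251] -/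
def VariationalThm1RegSepTop7MG (Sup : (ν : Stage7Numerics) → (K : ℕ) → (ℕ → Set (Site (F.P K) 0)) → Set (Site (F.P K) 0)) (Adm : StepGuard F) (B₃ a₀ a₁ : ℝ) : Prop :=
  ∀ (ν : Stage7Numerics) (M : ℕ) (g : ℕ → ℝ) (K k : ℕ) (s : SeqOfRecord F ν M g K k), Sect2.SeqSeparated ν.M₁ s → 0 < ν.M₁ → Adm ν M g K k s → ∀ (ε₀ : ℝ) (δ : ℕ → ℝ),
    (∀ n, n ≤ k → 0 < δ n ∧ δ n ≤ a₁ ∧ B₃ * δ n ≤ ε₀) → (∀ n, n < k → δ n ≤ 2 * δ (n + 1)) → (∀ n, n < k → δ (n + 1) ≤ 2 * δ n) → ε₀ ≤ a₀ →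
    ∀ W : MSField (F.P K) (SU N), Sect2.DataSmall7PTop (avOfRecord F N K) s.Ω (Sup ν K s.Ω) k δ W →
      ∀ U₀, IsMinimizer (avOfRecord F N K)
          {U | (∀ n, n ≤ k → PlaqSmallOn (Sect2.omegaPlaqsTop s.Ω (Sup ν K s.Ω) n) (ε₀ * (F.P K).eta n ^ 2) U) ∧
            Sect2.CoDivClassOnTop s.Ω (Sup ν K s.Ω) k ε₀ U} (genSet s.Ω k) W U₀ →
        (∀ n, n ≤ k → PlaqSmallOn (Sect2.omegaPlaqsTop s.Ω (Sup ν K s.Ω) n) (B₃ * δ n * (F.P K).eta n ^ 2) U₀) ∧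
          ∀ n, n ≤ k → Sect2.CoDivSmallOn (Sect2.omegaBondsTop s.Ω (Sup ν K s.Ω) n) (B₃ * δ n * (F.P K).eta n ^ 3) U₀

/-- The guard-generic `CoP` edition (at node00-def-R's selector). [cite: Balaban1985Variational, Thm 1 (7)–(8) pp.278–279; Balaban1988Convergent, p.255, (2.12) p.256] -/
def VariationalThm1RegSepCoP7MG (Adm : StepGuard F) (B₃ a₀ a₁ : ℝ) : Prop :=
  VariationalThm1RegSepTop7MG F N (fun ν K Ω => suppDomOfRecord F ν K Ω) Adm B₃ a₀ a₁

variable {F N}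

/-- Floor-free (12d) ⇒ guarded, every guard. [cite: Balaban1985Variational, Thm 1 (8) p.279 (bookkeeping)] -/
theorem VariationalThm1RegSepTop7M.toG {Sup : (ν : Stage7Numerics) → (K : ℕ) → (ℕ → Set (Site (F.P K) 0)) → Set (Site (F.P K) 0)} {B₃ a₀ a₁ : ℝ}
    (h : VariationalThm1RegSepTop7M F N Sup B₃ a₀ a₁) (Adm : StepGuard F) : VariationalThm1RegSepTop7MG F N Sup Adm B₃ a₀ a₁ :=
  fun ν M g K k s hsep hM₁ _ => h ν M g K k s hsep hM₁

/-- Antitone in the ceilings (guarded). [cite: Balaban1985Variational, Thm 1 p.279 (bookkeeping)] -/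
theorem VariationalThm1RegSepTop7MG.of_le {Sup : (ν : Stage7Numerics) → (K : ℕ) → (ℕ → Set (Site (F.P K) 0)) → Set (Site (F.P K) 0)} {Adm : StepGuard F}
    {B₃ a₀ a₀' a₁ a₁' : ℝ} (h : VariationalThm1RegSepTop7MG F N Sup Adm B₃ a₀ a₁) (ha₀ : a₀' ≤ a₀) (ha₁ : a₁' ≤ a₁) :
    VariationalThm1RegSepTop7MG F N Sup Adm B₃ a₀' a₁' :=
  fun ν M g K k s hsep hM₁ hadm ε₀ δ hnum hcomp hcomp' hε W h7 U₀ hmin =>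
    h ν M g K k s hsep hM₁ hadm ε₀ δ (fun n hn => ⟨(hnum n hn).1, (hnum n hn).2.1.trans ha₁, (hnum n hn).2.2⟩) hcomp hcomp' (hε.trans ha₀) W h7 U₀ hmin

/-- ANTITONE IN THE GUARD: a stronger guard asks the sentence of fewer prefixes. [cite: Balaban1985Variational, Thm 1 (8) p.279 (bookkeeping)] -/
theorem VariationalThm1RegSepTop7MG.of_imp {Sup : (ν : Stage7Numerics) → (K : ℕ) → (ℕ → Set (Site (F.P K) 0)) → Set (Site (F.P K) 0)} {Adm Adm' : StepGuard F}
    {B₃ a₀ a₁ : ℝ} (h : VariationalThm1RegSepTop7MG F N Sup Adm B₃ a₀ a₁) (himp : ∀ ν M g K k s, Adm' ν M g K k s → Adm ν M g K k s) :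
    VariationalThm1RegSepTop7MG F N Sup Adm' B₃ a₀ a₁ :=
  fun ν M g K k s hsep hM₁ hadm' => h ν M g K k s hsep hM₁ (himp ν M g K k s hadm')

/-- With the trivial guard the guarded sentence IS 12d's. [cite: Balaban1985Variational, Thm 1 (8) p.279 (bookkeeping)] -/
theorem variationalThm1RegSepTop7MG_top_iff {Sup : (ν : Stage7Numerics) → (K : ℕ) → (ℕ → Set (Site (F.P K) 0)) → Set (Site (F.P K) 0)} {B₃ a₀ a₁ : ℝ} :
    VariationalThm1RegSepTop7MG F N Sup (fun _ _ _ _ _ _ => True) B₃ a₀ a₁ ↔ VariationalThm1RegSepTop7M F N Sup B₃ a₀ a₁ :=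
  ⟨fun h ν M g K k s hsep hM₁ => h ν M g K k s hsep hM₁ trivial, fun h => h.toG _⟩

/-- §1's floor edition IS the instance `Adm := floorGuard F c`. [cite: Balaban1985RegularSpaces, (1.3)–(1.6) p.77 (bookkeeping)] -/
theorem variationalThm1RegSepTop7MR_iff_G_floorGuard {Sup : (ν : Stage7Numerics) → (K : ℕ) → (ℕ → Set (Site (F.P K) 0)) → Set (Site (F.P K) 0)} {c : ℕ} {B₃ a₀ a₁ : ℝ} :
    VariationalThm1RegSepTop7MR F N Sup c B₃ a₀ a₁ ↔ VariationalThm1RegSepTop7MG F N Sup (floorGuard F c) B₃ a₀ a₁ :=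
  Iff.rfl

/-- The `CoP` floor edition IS the instance `Adm := floorGuard F c`. [cite: Balaban1985RegularSpaces, (1.3)–(1.6) p.77 (bookkeeping)] -/
theorem variationalThm1RegSepCoP7MR_iff_G_floorGuard {c : ℕ} {B₃ a₀ a₁ : ℝ} :
    VariationalThm1RegSepCoP7MR F N c B₃ a₀ a₁ ↔ VariationalThm1RegSepCoP7MG F N (floorGuard F c) B₃ a₀ a₁ :=
  Iff.rfl

/-- Floor-free `CoP` ⇒ guarded `CoP`, every guard. [cite: Balaban1985Variational, Thm 1 (8) p.279 (bookkeeping)] -/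
theorem VariationalThm1RegSepCoP7M.toG {B₃ a₀ a₁ : ℝ} (h : VariationalThm1RegSepCoP7M F N B₃ a₀ a₁) (Adm : StepGuard F) :
    VariationalThm1RegSepCoP7MG F N Adm B₃ a₀ a₁ :=
  VariationalThm1RegSepTop7M.toG h Adm

/-- The guarded `CoP` sentence is antitone in the guard. [cite: Balaban1985Variational, Thm 1 (8) p.279 (bookkeeping)] -/
theorem VariationalThm1RegSepCoP7MG.of_imp {Adm Adm' : StepGuard F} {B₃ a₀ a₁ : ℝ} (h : VariationalThm1RegSepCoP7MG F N Adm B₃ a₀ a₁)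
    (himp : ∀ ν M g K k s, Adm' ν M g K k s → Adm ν M g K k s) : VariationalThm1RegSepCoP7MG F N Adm' B₃ a₀ a₁ :=
  VariationalThm1RegSepTop7MG.of_imp h himp

/-- A floor-carrying `CoP` sentence serves every guard implying its floor. [cite: Balaban1985RegularSpaces, (1.3)–(1.6) p.77 (bookkeeping)] -/
theorem VariationalThm1RegSepCoP7MR.toG_of_imp_floor {c : ℕ} {Adm : StepGuard F} {B₃ a₀ a₁ : ℝ} (h : VariationalThm1RegSepCoP7MR F N c B₃ a₀ a₁)
    (himp : ∀ ν M g K k s, Adm ν M g K k s → c ≤ ν.M₁) : VariationalThm1RegSepCoP7MG F N Adm B₃ a₀ a₁ :=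
  (variationalThm1RegSepCoP7MR_iff_G_floorGuard.1 h).of_imp himp

/-- The plaquette accessor under any guard — 12d's `plaqSmallOn_of_thm1RegSepTop7M` with `(hadm : Adm ν M g K k s)`. [cite: Balaban1985Variational, Thm 1 (2),(6)–(8) pp.278–279; Balaban1988Convergent, (2.12) p.256] -/
theorem plaqSmallOn_of_thm1RegSepTop7MG {Sup : (ν : Stage7Numerics) → (K : ℕ) → (ℕ → Set (Site (F.P K) 0)) → Set (Site (F.P K) 0)} {Adm : StepGuard F} {B₃ a₀ a₁ : ℝ}
    (h15 : VariationalThm1RegSepTop7MG F N Sup Adm B₃ a₀ a₁) (ν : Stage7Numerics) (M : ℕ)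
    (g : ℕ → ℝ) (K k : ℕ) (cR : ℝ) (s : SeqOfRecord F ν M g K k) (hsep : Sect2.SeqSeparated ν.M₁ s) (hM₁ : 0 < ν.M₁) (hadm : Adm ν M g K k s)
    (hnum : ∀ n, n ≤ k → 0 < cR * epsOfRecord ν g n ∧ cR * epsOfRecord ν g n ≤ a₁ ∧ B₃ * (cR * epsOfRecord ν g n) ≤ ν.εreg) (ha₀ : ν.εreg ≤ a₀)
    (hcomp : ∀ n, n < k → cR * epsOfRecord ν g n ≤ 2 * (cR * epsOfRecord ν g (n + 1)))
    (hcomp' : ∀ n, n < k → cR * epsOfRecord ν g (n + 1) ≤ 2 * (cR * epsOfRecord ν g n))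
    {W : MSField (F.P K) (SU N)} (h7 : Sect2.DataSmall7PTop (avOfRecord F N K) s.Ω (Sup ν K s.Ω) k (fun n => cR * epsOfRecord ν g n) W)
    {U₀ : GaugeField (F.P K) 0 (SU N)} (hmin : IsMinimizer (avOfRecord F N K)
      {U | (∀ n, n ≤ k → PlaqSmallOn (Sect2.omegaPlaqsTop s.Ω (Sup ν K s.Ω) n) (ν.εreg * (F.P K).eta n ^ 2) U) ∧
        Sect2.CoDivClassOnTop s.Ω (Sup ν K s.Ω) k ν.εreg U} (genSet s.Ω k) W U₀) :
    ∀ n, n ≤ k → PlaqSmallOn (Sect2.omegaPlaqsTop s.Ω (Sup ν K s.Ω) n) (B₃ * (cR * epsOfRecord ν g n) * (F.P K).eta n ^ 2) U₀ :=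
  (h15 ν M g K k s hsep hM₁ hadm ν.εreg (fun n => cR * epsOfRecord ν g n) hnum hcomp hcomp' ha₀ W h7 U₀ hmin).1

/-- The co-divergence accessor under any guard. [cite: Balaban1985Variational, Thm 1 (8) p.279; Balaban1985RegularSpaces, (1.9) p.77] -/
theorem coDivSmallOn_of_thm1RegSepTop7MG {Sup : (ν : Stage7Numerics) → (K : ℕ) → (ℕ → Set (Site (F.P K) 0)) → Set (Site (F.P K) 0)} {Adm : StepGuard F} {B₃ a₀ a₁ : ℝ}
    (h15 : VariationalThm1RegSepTop7MG F N Sup Adm B₃ a₀ a₁) (ν : Stage7Numerics) (M : ℕ)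
    (g : ℕ → ℝ) (K k : ℕ) (cR : ℝ) (s : SeqOfRecord F ν M g K k) (hsep : Sect2.SeqSeparated ν.M₁ s) (hM₁ : 0 < ν.M₁) (hadm : Adm ν M g K k s)
    (hnum : ∀ n, n ≤ k → 0 < cR * epsOfRecord ν g n ∧ cR * epsOfRecord ν g n ≤ a₁ ∧ B₃ * (cR * epsOfRecord ν g n) ≤ ν.εreg) (ha₀ : ν.εreg ≤ a₀)
    (hcomp : ∀ n, n < k → cR * epsOfRecord ν g n ≤ 2 * (cR * epsOfRecord ν g (n + 1)))
    (hcomp' : ∀ n, n < k → cR * epsOfRecord ν g (n + 1) ≤ 2 * (cR * epsOfRecord ν g n))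
    {W : MSField (F.P K) (SU N)} (h7 : Sect2.DataSmall7PTop (avOfRecord F N K) s.Ω (Sup ν K s.Ω) k (fun n => cR * epsOfRecord ν g n) W)
    {U₀ : GaugeField (F.P K) 0 (SU N)} (hmin : IsMinimizer (avOfRecord F N K)
      {U | (∀ n, n ≤ k → PlaqSmallOn (Sect2.omegaPlaqsTop s.Ω (Sup ν K s.Ω) n) (ν.εreg * (F.P K).eta n ^ 2) U) ∧
        Sect2.CoDivClassOnTop s.Ω (Sup ν K s.Ω) k ν.εreg U} (genSet s.Ω k) W U₀) :
    ∀ n, n ≤ k → Sect2.CoDivSmallOn (Sect2.omegaBondsTop s.Ω (Sup ν K s.Ω) n) (B₃ * (cR * epsOfRecord ν g n) * (F.P K).eta n ^ 3) U₀ :=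
  (h15 ν M g K k s hsep hM₁ hadm ν.εreg (fun n => cR * epsOfRecord ν g n) hnum hcomp hcomp' ha₀ W h7 U₀ hmin).2

/-- ★ Module 20's minimiser lemma from the GUARDED stub-1 fact (module 47's `Prop8RegSepTopStepG`), pointwise with `hadm`. [cite: Balaban1985Variational, Thm 1 (6)–(8) pp.278–279, p.299, Prop. 8 p.304; Balaban1988Convergent, (2.12) p.256] -/
theorem regular_of_isMinimizer_classTop_of_prop8TopStepG {Sup : (ν : Stage7Numerics) → (K : ℕ) → (ℕ → Set (Site (F.P K) 0)) → Set (Site (F.P K) 0)}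
    {Adm : StepGuard F} {B₃ a₀ a₁ : ℝ} (h8 : Prop8RegSepTopStepG F N Sup Adm B₃ a₀ a₁) (ν : Stage7Numerics) (M : ℕ)
    (g : ℕ → ℝ) (K k : ℕ) (s : SeqOfRecord F ν M g K k) (hsep : Sect2.SeqSeparated ν.M₁ s) (hM₁ : 0 < ν.M₁) (hadm : Adm ν M g K k s) (hk : 1 ≤ k)
    (ε₀ : ℝ) (δ : ℕ → ℝ) (hδ : ∀ n, n ≤ k → 0 < δ n ∧ δ n ≤ a₁ ∧ B₃ * δ n ≤ ε₀) (hcomp : ∀ n, n < k → δ n ≤ 2 * δ (n + 1))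
    (hcomp' : ∀ n, n < k → δ (n + 1) ≤ 2 * δ n) (hε₀ : ε₀ ≤ a₀)
    (W : MSField (F.P K) (SU N)) (h7 : Sect2.DataSmall7PTop (avOfRecord F N K) s.Ω (Sup ν K s.Ω) k δ W) {U₀ : GaugeField (F.P K) 0 (SU N)}
    (hU₀ : IsMinimizer (avOfRecord F N K)
      {U | (∀ n, n ≤ k → PlaqSmallOn (Sect2.omegaPlaqsTop s.Ω (Sup ν K s.Ω) n) (ε₀ * (F.P K).eta n ^ 2) U) ∧
        Sect2.CoDivClassOnTop s.Ω (Sup ν K s.Ω) k ε₀ U} (genSet s.Ω k) W U₀) :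
    (∀ n, n ≤ k → PlaqSmallOn (Sect2.omegaPlaqsTop s.Ω (Sup ν K s.Ω) n) (B₃ * δ n * (F.P K).eta n ^ 2) U₀) ∧
      ∀ n, n ≤ k → Sect2.CoDivSmallOn (Sect2.omegaBondsTop s.Ω (Sup ν K s.Ω) n) (B₃ * δ n * (F.P K).eta n ^ 3) U₀ :=
  h8 ν M g K k s hsep hM₁ hadm hk ε₀ δ hδ hcomp hcomp' hε₀ W h7 U₀ hU₀.1.1 hU₀.1.2 hU₀.2.1 (isCritOnFibre_of_isMinimizer_classTop hU₀)

end NamedFactTopMG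

end Literature.MathematicalPhysics.QuantumFieldTheory.Balaban1983to89.Node00

end
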